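import Summits.BirchSwinnertonDyer.BirchSwinnertonDyer.Theorems.ErratumRoadFiveOpenInputNotRamBDPFrameDescentStub
import Literature.NumberTheory.EllipticCurves.Hsieh2014.AnticyclotomicPAdicLFunctionAnyLevel
import HarnessLib

set_option linter.dupNamespace false -- `Summit.BirchSwinnertonDyer.BirchSwinnertonDyer.Theorems.…` (summit = sub)
set_option autoImplicit false

/-!
# Crux (E♭°) `EisensteinDivisibilityCMInertBadFlatAtOne` (stmt-BirchSwinnertonDyer-20452), line `birth`:
# stub `stub_E0` (EXISTENCE of an `R₀`-valued BDP frame at an ADDITIVE prime, `p² ∣ N`) REDUCED to two refereed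
# named facts by the tree's general `R₀`-DESCENT — CONDITIONAL helper

Route `BiquadraticEisensteinDescent` (cell `pub/bsd-wall`, lead-prover seat `bsd-wall-bed-p1`, g2). Skeleton of
record v2 (sha16 `c35ce51d8c75e0b4`): `stub_E0` asks, at a ♭-frame of `(f, K′, 𝔭, κ, γ)`, for SOME
`R₀`-frame `(Ω_K′₁ ≠ 0, Ω_p₁ ∈ R₀ˣ, L₁ ∈ R₀⟦T⟧)` with Castella's interpolation property
`IsBDPLFunction ι′ 𝔭 κ γ f Ω_K′₁ Ω_p₁ L₁`. The tree's named existence fact (Castella 2018 Thm. 3.1,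
`castella2018_exists_isBDPLFunction`) carries `Squarefree N` and is silent at an additive prime. This file obtains
the `R₀`-frame at EVERY level divisible by `p` — in particular `p² ∣ N` — by the road cell `bsd-stepL` built for
`p ∥ N` (`Theorems/ErratumRoadFiveOpenInputNotRamBDPFrameDescent[Stub].lean`), whose descent step never used
`p² ∤ N`:

  λ-supply `X11b.lambdaSupplyAt` ⟶ (A∞) Hsieh's Thm. A AT ANY LEVEL with `Ω_p ∈ 𝒲^× = R₀^×`
  (`Hsieh2014.thmA_exists_isHsiehLFunction_unrPeriod_anyLevel`, the route's support item `HsiehAnyLevelInput`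
  stmt-BirchSwinnertonDyer-20456) ⟶ an `𝓞_{ℂ_p}`-valued Hsieh witness `Q` ⟶ (R) BDP13 Thm. 5.5 central-value
  reciprocity (`bertoliniDarmonPrasanna2013_centralValue_reciprocity`, `K′` of ODD discriminant) gives the
  inertially reciprocal period (`inertialValueReciprocity_of_bdp2013`) ⟶ `R₀`-descent
  `exists_isBDPLFunction_of_inertialReciprocity_of_unrPeriodWitness` (`p ∣ N`, `𝔭` of degree one).

* `exists_isBDPLFunction_of_thmA_anyLevel_of_bdp2013` — the `R₀`-frame at every classical datum with `p ∣ N`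
  (no condition on `v_p(N)`), `K` imaginary quadratic of odd discriminant, Heegner for `N`, `𝔭 ∋ p` of degree
  one induced by `ι′`, `κ` anticyclotomic with topological generator `γ`. CONDITIONAL on (A∞) and (R).
* `stub_E0_of_thmA_anyLevel_of_bdp2013_of_odd` — the registered `stub_E0` signature with (A∞), (R) in front and
  `Odd (discr K′)` added after the Heegner binder; otherwise VERBATIM (CM, rank, admissibility, `L(W^{d},1) ≠ 0`,
  the ♭-frame `Q` are idle). A HELPER (conditional; `Odd d_K′` is not a binder of the crux), not the stub.

THEOREMS ONLY (no definition, no named fact, no `sorry`); imports no `Theses` module; nothing about the crux or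
any case of BSD is asserted. Supports, does not close, stmt-BirchSwinnertonDyer-20452.

References: [Hsieh2014] Thm. A / Thm. 1 (Doc. Math. 19 p. 712; arXiv:1112.1580 pp. 3–4) and Thm. 5.6 (p. 23);
[BertoliniDarmonPrasanna2013] Thm. 5.5, (5.1.16) (p. 60); [Castella2018] Thm. 3.1 (arXiv:1704.06608 p. 9);
[CastellaHsieh2018] §2.5.
-/

noncomputable section

open scoped Classical NumberField

open PowerSeries NumberField IsDedekindDomain Field WeierstrassCurve
  Literature.NumberTheory.EllipticCurves Literature.NumberTheory.EllipticCurves.ModularForms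
  Literature.NumberTheory.EllipticCurves.Rank1Residual
  Literature.NumberTheory.GaloisRepresentations Literature.NumberTheory.Automorphic
  Literature.NumberTheory.EllipticCurves.Hsieh2014
  Summit.BirchSwinnertonDyer.Rank1Residual.X11b

namespace Summit.BirchSwinnertonDyer.BirchSwinnertonDyer.Theorems.BiquadraticEisensteinDescentEisensteinDivisibilityCMInertBadFlatAtOneStubE0

/-- **An `R₀`-frame at EVERY level divisible by `p` (additive primes included), from Hsieh's Thm. A at any level
and BDP13 reciprocity, by descent.** Data: `p` odd; `W/ℚ` elliptic with newform `f` of level `N = N_W`, `p ∣ N`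
(ANY `v_p(N)`); `K` imaginary quadratic of ODD discriminant satisfying the Heegner hypothesis for `N` (so `p`
splits); `𝔭 ∋ p` of degree one with the compatibility clause for `ι′`; `κ` anticyclotomic with topological generator
`γ`. Conclusion: `∃ (Ω_K ≠ 0) (Ω_p ∈ R₀ˣ) (L ∈ R₀⟦T⟧), IsBDPLFunction ι′ 𝔭 κ γ f Ω_K Ω_p L`. Proof = the
`bsd-stepL` road `exists_isBDPLFunction_of_hsieh2014_unrPeriod_of_bdp2013` with Hsieh's `p ∥ N` fact replaced by
the any-level fact (A∞): λ-supply ⟶ Hsieh witness with `Ω_p ∈ R₀ˣ` ⟶ inertially reciprocal period (R) ⟶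
`exists_isBDPLFunction_of_inertialReciprocity_of_unrPeriodWitness`. CONDITIONAL on the two named facts.
[cite: Hsieh2014, Thm. A p. 712 (Doc. Math. 19) = Thm. 1 (arXiv:1112.1580 pp. 3–4)]
[cite: BertoliniDarmonPrasanna2013, Thm. 5.5 and (5.1.16) (p. 60)] [cite: Castella2018, Thm. 3.1 (arXiv:1704.06608 p. 9)] -/
theorem exists_isBDPLFunction_of_thmA_anyLevel_of_bdp2013
    (hA : thmA_exists_isHsiehLFunction_unrPeriod_anyLevel)
    (hR : bertoliniDarmonPrasanna2013_centralValue_reciprocity)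
    {p : ℕ} [Fact p.Prime] (hp2 : p ≠ 2) (ι' : PadicAlgCl p ≃+* ℂ) (W : WeierstrassCurve ℚ) [W.IsElliptic]
    (K : Type) [Field K] [NumberField K] (𝔭 : HeightOneSpectrum (𝓞 K)) (κ : ZpExtension K p)
    (γ : Field.absoluteGaloisGroup K) {N : ℕ} [NeZero N] {f : CuspForm (CongruenceSubgroup.Gamma0 N) 2}
    (hf : IsNewformOf W f) (hN : W.conductorNorm ℤ = N) (hpN : p ∣ N)
    (hKiq : IsImaginaryQuadratic K) (hodd : Odd (NumberField.discr K)) (hHeeg : SatisfiesHeegnerHypothesis N K)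
    (hp𝔭 : ((p : ℕ) : 𝓞 K) ∈ 𝔭.asIdeal) (hram : 𝔭.asIdeal.ramificationIdx (𝓞 ℚ) = 1)
    (hdeg : 𝔭.asIdeal.inertiaDeg (𝓞 ℚ) = 1)
    (hι𝔭 : ∀ (w : InfinitePlace K) (k : 𝓞 K), k ∈ 𝔭.asIdeal ↔ ‖ι'.symm (w.embedding (k : K))‖ < 1)
    (hκa : κ.IsAnticyclotomic) (hγ : κ.IsTopGenerator γ) :
    ∃ (ΩK : ℂ) (Ωp : (unrIntegers p)ˣ) (L : UnrSeries p), ΩK ≠ 0 ∧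
      IsBDPLFunction ι' 𝔭 κ γ f ΩK ((Ωp : unrIntegers p) : ℂ_[p]) L := by
  have hp : p.Prime := Fact.out
  have hsplit : ((Ideal.span {(p : ℤ)}).primesOver (𝓞 K)).ncard = 2 := hHeeg p hp hpN
  -- the λ-supply at `(ι', K, κ)` (class field theory; tree theorem at every odd `p`)
  obtain ⟨lam, rlam, hunit, hinfl, hAQ, hunrl, havl, hfacl⟩ := lambdaSupplyAt hp2 ι' K κ hKiq hκa
  -- Hsieh's any-level witness with `Ω_p ∈ R₀ˣ`
  obtain ⟨A, ΩK, C, Ωp, Q, hA0, hΩK, hC, hQ⟩ :=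
    hA ι' K 𝔭 κ γ f lam rlam hp2 hf.1 hKiq hsplit hp𝔭 hι𝔭 hHeeg hunit hinfl hAQ hunrl havl hfacl hκa hγ
  -- the inertially reciprocal period
  obtain ⟨Ω, hΩ, hVRB⟩ := inertialValueReciprocity_of_bdp2013 hR hp2 ι' W K hf hN hKiq hodd hHeeg hsplit 𝔭
  exact exists_isBDPLFunction_of_inertialReciprocity_of_unrPeriodWitness hp2 ι' hpN hKiq hp𝔭 hram hdeg hκa hγ
    Ωp hA0 hΩK hC hQ hΩ hVRB

/-- **The registered `stub_E0` of crux (E♭°), WITH its two published inputs and the parity clause ADDED as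
hypotheses** — (A∞) `Hsieh2014.thmA_exists_isHsiehLFunction_unrPeriod_anyLevel` and (R)
`bertoliniDarmonPrasanna2013_centralValue_reciprocity` in front, `Odd (discr K′)` after the Heegner binder — and
otherwise the stub's binders VERBATIM (the CM / rank / admissibility / `L(W^{d_K′},1) ≠ 0` binders and the given
♭-frame `Q` are idle: the `R₀`-frame is built independently of `Q`). From the crux's binders: `p ≠ 2` (`5 ≤ p`),
`p ∣ N` (bad reduction). A HELPER (conditional on (A∞), (R); `Odd d_K′` is not a crux binder), not the stub.
[cite: Hsieh2014, Thm. A p. 712 (Doc. Math. 19)] [cite: BertoliniDarmonPrasanna2013, Thm. 5.5 (p. 60)] -/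
theorem stub_E0_of_thmA_anyLevel_of_bdp2013_of_odd
    (hA : thmA_exists_isHsiehLFunction_unrPeriod_anyLevel)
    (hR : bertoliniDarmonPrasanna2013_centralValue_reciprocity) :
  ∀ (W : WeierstrassCurve ℚ) [W.IsElliptic] [W.IsGloballyMinimal] (p : ℕ) [Fact p.Prime]
    [NeZero (W.conductorNorm ℤ)] (K : Type) [Field K] [NumberField K],
    W.HasCM → W.analyticRank = 1 → 5 ≤ p → CMInert W p → ¬ Good W p →
    IsImaginaryQuadratic K → SatisfiesHeegnerHypothesis (W.conductorNorm ℤ) K → Odd (NumberField.discr K) →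
    4 < (NumberField.discr K).natAbs →
    (∀ (M : Type) [Field M] [NumberField M], Module.finrank ℚ M = 4 →
      (∃ x : M, x ^ 2 = ((cmFieldDiscrOfJ W.j : ℤ) : M)) → (∃ y : M, y ^ 2 = ((NumberField.discr K : ℤ) : M)) →
      ¬ p ∣ NumberField.classNumber M) →
    (W.quadraticTwist (NumberField.discr K : ℚ)).entireLFunction 1 ≠ 0 →
    ∀ (κ : ZpExtension K p), κ.IsAnticyclotomic →
      ∀ (γ : Field.absoluteGaloisGroup K) [Fact (κ.IsTopGenerator γ)]
        (𝔭 : HeightOneSpectrum (𝓞 K)), ((p : ℕ) : 𝓞 K) ∈ 𝔭.asIdeal →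
        𝔭.asIdeal.ramificationIdx (𝓞 ℚ) = 1 → 𝔭.asIdeal.inertiaDeg (𝓞 ℚ) = 1 →
        ∀ (f : CuspForm (CongruenceSubgroup.Gamma0 (W.conductorNorm ℤ)) 2), IsNewformOf W f →
          ∀ (ι' : PadicAlgCl p ≃+* ℂ),
            (∀ (w : InfinitePlace K) (k : 𝓞 K), k ∈ 𝔭.asIdeal ↔ ‖ι'.symm (w.embedding (k : K))‖ < 1) →
            ∀ (ΩK : ℂ) (Ωp : (unrIntegers p)ˣ) (Q : PowerSeries 𝓞_ℂ_[p]), ΩK ≠ 0 →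
              R1.IsBDPLFunctionInt p ι' 𝔭 κ γ f ΩK ((Ωp : unrIntegers p) : ℂ_[p]) Q →
                ∃ (ΩK₁ : ℂ) (Ωp₁ : (unrIntegers p)ˣ) (L₁ : UnrSeries p), ΩK₁ ≠ 0 ∧
                  IsBDPLFunction ι' 𝔭 κ γ f ΩK₁ ((Ωp₁ : unrIntegers p) : ℂ_[p]) L₁ := by
  intro W _ _ p _ _ K _ _ _hCM _hr hp5 _hin hbad hK hHN hodd _hd4 _hadm _hLt κ hκ γ hγ 𝔭 h𝔭 he hfdeg f hfW ι'
    hι' _ΩK _Ωp _Q _hΩK _hQ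
  have hp2 : p ≠ 2 := by omega
  have hpN : p ∣ W.conductorNorm ℤ := (W.dvd_conductorNorm_iff_not_hasGoodReductionAtPrime p).mpr hbad
  exact exists_isBDPLFunction_of_thmA_anyLevel_of_bdp2013 hA hR hp2 ι' W K 𝔭 κ γ hfW rfl hpN hK hodd hHN h𝔭
    he hfdeg hι' hκ hγ.out

end Summit.BirchSwinnertonDyer.BirchSwinnertonDyer.Theorems.BiquadraticEisensteinDescentEisensteinDivisibilityCMInertBadFlatAtOneStubE0

end
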